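import Summits.QuantumFields.YangMills.Theorems.UnitScaleTiltProp7PosOfGaugeFixed
import Summits.QuantumFields.YangMills.Theorems.UnitScaleTiltProp7SectET3WilsonHessianT3RealityRows
import Summits.QuantumFields.YangMills.Theorems.UnitScaleTiltProp7SectET3OpsT3HilbertRows
import HarnessLib

/-!
# Route `UnitScaleTilt`, crux «MinimiserStabilityRegPr» (stmt-QuantumFields-19200, stub EX), node N06(d = 3), route (α) — **THE SCHUR DOOR OF THE γ-ROW:
# THE GAUGE-FIXED SLICE FLOOR OF [Balaban1985BackgroundPropagators] Thm 3.11 FROM A TRANSVERSE FLOOR (T), A SLICE-GAUGE FLOOR (G) AND A ONE-SIDED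
# MIXING ROW (X) IN ENERGY CURRENCY**, over the Hodge split `A = Y + D_{U₀}μ`, `D*_{U₀}Y = 0` of the weighted `L²` letters — every background `U₀`, every slot operator

Cell `ym3-torus` (HUMAN RULING D-0037, YM ladder rung R3 — YM₃ on T³ is a RUNG, NOT d = 4, NOT the Clay problem; the YM mass gap is NOT proved).  Fleet lead seat
`ym-ust-19200-p1` (gen 23), positivity-block lane of the EX face; pen (X) «unsigned mixing» of LOCATE-GAMMA-ROW-p1g22 §1∕§3 (★★OWNER ym3-torus-plan g32 ROUTING WORD
2026-08-29T19:10:15Z: «R3 19200-positivity pens = (T) + (X) only; (X) unsigned mixing → ★p1 g23 (consumes (a))»).  THEOREMS ONLY (0 `def`, 0 `sorry`);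
`--supports stmt-QuantumFields-19200 --as helper`; count-neutral.

THE PRINT.  [Balaban1985BackgroundPropagators] Thm 3.11 p. 416 *«the operators Δ′_a, G′, (Q′G′²Q′*)⁻¹, Δ_a, G are positive definite»*; (3.118)–(3.122) pp. 419–420
*«A = A′ + Dλ, λ = G′RD*A … RD*A′ = 0 … G⁻¹ = Δ_π + DRD* + Q*aQ»*; (3.114)–(3.115) p. 418 *«Q_kDλ = D_kQ′_kλ»*; (3.8) p. 392 *«D* is the adjoint of D»*.
[Balaban1984PropagatorsI] Prop. 1.1 (1.90) p. 33 (the flat floor, mode by mode).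

WHY THIS FILE (LOCATE-GAMMA-ROW-p1g22 §1, by kernel in ✓`Prop7CoerciveOfGaugeFixedLift` ∕ ✓`Prop7PositivityBlockDoorLift`).  Behind the `Lift` antecedent of record the EX face's
positivity block (`hPos₁ hPosπ hPosΔ`) follows from ONE analytic input, the γ-ROW `γ‖A‖² ≤ re⟨A, Δ^η(U₀)A⟩ + a‖Q_k(U₀)A‖²` on the slice `{R_S(U₀) D*_{U₀} A = 0}` (the `hGF` binder of
✓`positivityRows_liftRecord_of_gaugeFixedRow`).  The slice is NOT the Landau gauge: with the Hodge split `A = Y + D_{U₀}μ`, `D*_{U₀}Y = 0` it contains every transverse `Y` AND the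
«averaging-visible» gauge directions `D_{U₀}μ` with `R_S(U₀) Δ^η_{U₀} μ = 0`, on which only the averaging penalty acts.  LOCATE §1 therefore splits the γ-row into
(T) a floor on transverse fields, (G) a floor on the slice gauge directions (curved = Track A node N06, NOT an R3 pen) and (X) the UNSIGNED mixing
`re⟨Y, M Dμ⟩ + re⟨Dμ, M Y⟩ + 2a·re⟨Q_kY, Q_kDμ⟩`.  THIS FILE IS THE KNIT: it proves, for EVERY background and EVERY slot operator `M` (e.g. `Δ^η`, `Δ^η + T_J`), that
(T) ∧ (G) ∧ (X) ⟹ the γ-row with an explicit constant, where (X) is displayed ONE-SIDED and in ENERGY CURRENCY — the mixing may borrow fractions `θ_T`, `θ_G ≤ 1` of the two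
energies plus an `L² × L²` term `m‖Y‖‖Dμ‖` (LOCATE-RCORE (γ): «the split must be done in the right variables» — a pure `L² × L²` bound is false at face value with print's numbers) —
and that (T) and (G) are NECESSARY (each is the γ-row restricted to a subspace of the slice), so neither row is mis-stated.  The (X) row's averaging term is rewritten through the
intertwiner `Q(U₀)∘D_{U₀} = D′∘Q″` of ✓`Prop7NSIntertwinerOfRecord.exists_intertwiner_of_regPr` (the shape pen (a) — the adjoint intertwiner, routeR-w3 — plugs into), and reduced to
the distance of `Q_kY` from the orthocomplement of the coarse gauge direction (the quantity (1.90) controls mode by mode).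

WHAT IS PROVED (ns `…Theorems.Prop7GaugeFixedFloorSchurDoor`; member `F n K`, `h : n ≤ K`, weights `c₀ cB > 0`, coupling `a : ℝ`, ANY background `U₀`, ANY `ℂ`-linear slot `M`).
* §1 `floor_arith` — the real-number Schur step: `c_T s² ≤ E_T`, `c_G t² ≤ E_G`, `−(θ_T E_T + θ_G E_G + m·st) ≤ X`, `θ_T, θ_G ≤ 1`, `0 ≤ m` ⟹
  `(min((1−θ_T)c_T, (1−θ_G)c_G) − m∕2)(s² + t²) ≤ E_T + E_G + X`.
* §2 THE HODGE SPLIT IN THE HILBERT LETTERS (every `U₀`; `⟪Dμ, Y⟫ = ⟪μ, D*Y⟫` is ✓`Prop7SectET3OpsT3HilbertRows.inner_DL2_left`, reused): `inner_DL2_eq_zero_of_transverse`, ★ `exists_hodge_split`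
  (`A = Y + D_{U₀}μ`, `D*_{U₀}Y = 0`, `‖A‖² = ‖Y‖² + ‖D_{U₀}μ‖²` — orthogonal projection onto `range D_{U₀}`), ★ `RS_covLapSite_eq_zero_of_slice` (on the slice the potential has
  `R_S Δ^η_{U₀} μ = 0`).
* §3 `re_inner_add_map_add`, `norm_sq_map_add`, `re_inner_symm_of_isSymmetric` — the three-line algebra of the expansion.
* §4 ★★★ `gaugeFixedFloor_of_TGX` — THE DOOR (general slot `M`); ★★ `gaugeFixedFloor_of_TGX_of_isSymmetric` (symmetric slot: mixing `2re⟨Y, M Dμ⟩ + 2a re⟨Q_kY, Q_kDμ⟩`);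
  ★★ `gaugeFixedFloor_DeltaEta_of_TGX` (the slot of the `hGF` binder, `M := Δ^η(U₀)`, symmetric by ✓`DeltaEta_isSymmetric`).
* §5 NECESSITY: ★ `transverseFloor_of_gaugeFixedFloor` ((T) with `c_T := γ`), ★ `sliceGaugeFloor_of_gaugeFixedFloor` ((G) with `c_G := γ`) — both rows are restrictions of the γ-row.
* §6 THE AVERAGING PART OF (X) IN INTERTWINER LETTERS: `inner_Qk_Qk` (`⟪Q_ku, Q_kv⟫ = η²⟪Qu, Qv⟫`), ★ `inner_Qk_Qk_DL2_of_intertwiner` (`⟪Q_kY, Q_kDμ⟫ = η²⟪QY, D′(Q″μ)⟫` under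
  `Q∘D = D′∘Q″`), ★ `abs_re_inner_le_of_orthogonal` (`|re⟪u, v⟫| ≤ ‖u − w‖·‖v‖` for every `w ⊥ v`: only the component of `Q_kY` along the coarse gauge direction mixes).
* §7 ★★★ `hGF_of_TGX_rows` — THE FAMILY DOOR: the `hGF` binder of ✓`Prop7PositivityBlockDoorLift.positivityRows_liftRecord_of_gaugeFixedRow` VERBATIM (slot `Δ^η`, radius `αcap`)
  from family-level rows (T), (G), (X) under the same binders, `γ L i := min((1−θ_T)c_T, (1−θ_G)c_G) − m∕2` (all five constants may depend on `L`, `i`).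
EFFECT (numbers, not adjectives): the γ-row's three pieces of LOCATE-GAMMA-ROW §1 now have KERNEL signatures and a kernel composition; the window is `m∕2 < min((1−θ_T)c_T, (1−θ_G)c_G)`
(no `c_T·c_G` product condition: the energy fractions absorb the curl–curl and penalty–penalty Cauchy–Schwarz terms).  What a supplier owes is unchanged in class: (T) transverse
(engine ✓`Prop7CovariantOffKernel` + ✓`principal_two_sided_of_regPr`, missing the `QTwS` ↔ straight-average comparison — pen (b), w7), (G) curved = N06 proper (Track A), (X) the two
mixing estimates in the displayed currency.
HONEST SCOPE.  Finite-dimensional linear algebra (orthogonal projection, adjointness, Cauchy–Schwarz) over landed letters; no estimate of print is proved; the rows (T), (G), (X), the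
γ-row, `hPos₁ hPosπ hPosΔ`, the other print rows, `hThm2S`, EX and the crux are NOT proved; nothing continuum ∕ OS ∕ mass-gap ∕ Clay.

References: T. Bałaban, CMP **99** (1985) 389–434 [Balaban1985BackgroundPropagators] (Thm 3.11 p.416, (3.118)–(3.122) pp.419–420, (3.114)–(3.115) p.418, (3.8) p.392,
(3.21)–(3.26) pp.394–395); CMP **95** (1984) 17–40 [Balaban1984PropagatorsI] (Prop. 1.1 (1.90) p.33); T. Kato, *Perturbation Theory for Linear Operators* (1966) VI §1.6 (form sums, KLMN) [Kato1966].
-/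

set_option autoImplicit false

noncomputable section

open scoped InnerProductSpace ComplexConjugate Matrix.Norms.L2Operator

namespace Summit.QuantumFields.YangMills.Theorems.Prop7GaugeFixedFloorSchurDoor

open Literature.MathematicalPhysics.QuantumFieldTheory.Balaban1983to89
open Literature.MathematicalPhysics.QuantumFieldTheory.Balaban1983to89.T3ContinuumYM3Torus
open Literature.MathematicalPhysics.QuantumFieldTheory.Balaban1983to89.T3PrintedRegularMinimiser (RegPr)
open Literature.MathematicalPhysics.QuantumFieldTheory.Balaban1983to89.T3Thm1Carrier (Idx)
open T3SectALandauChart (eta eta_pos)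
open B9Eq311L2Pairing (WL2)
open B11Eq103H1Complex (SiteL2K BondL2K)
open Summit.QuantumFields.YangMills.Theorems.Prop7SectET3Transport (periodsT3)
open Summit.QuantumFields.YangMills.Theorems.Prop7SectET3HilbertLetters (W₂ QL2 DL2 DstarL2 covLapSite)
open Summit.QuantumFields.YangMills.Theorems.Prop7SectET3GaugeProjector (RS)
open Summit.QuantumFields.YangMills.Theorems.Prop7SectET3WilsonHessian (DeltaEta DeltaEta_isSymmetric)
open Summit.QuantumFields.YangMills.Theorems.Prop7SectET3CurvedPropagators (Qk)
open Summit.QuantumFields.YangMills.Theorems.Prop7SectET3OpsT3HilbertRows (inner_DL2_left)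

/-! ## §1 The real-number Schur step (energy currency, one-sided mixing) -/

/-- **THE SCHUR STEP.**  Energies `E_T ≥ c_T s²`, `E_G ≥ c_G t²` and a mixing term bounded BELOW by `−(θ_T E_T + θ_G E_G + m·s·t)` with `θ_T, θ_G ≤ 1`, `0 ≤ m` give
`(min((1−θ_T)c_T, (1−θ_G)c_G) − m∕2)·(s² + t²) ≤ E_T + E_G + X` (`2st ≤ s² + t²`; the arithmetic of the KLMN form-sum bound). [cite: Kato1966, VI §1.6] -/
theorem floor_arith {cT cG θT θG m s t ET EG X : ℝ} (hθT : θT ≤ 1) (hθG : θG ≤ 1) (hm : 0 ≤ m)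
    (hT : cT * s ^ 2 ≤ ET) (hG : cG * t ^ 2 ≤ EG) (hX : -(θT * ET + θG * EG + m * (s * t)) ≤ X) :
    (min ((1 - θT) * cT) ((1 - θG) * cG) - m / 2) * (s ^ 2 + t ^ 2) ≤ ET + EG + X := by
  have h1 : (1 - θT) * (cT * s ^ 2) ≤ (1 - θT) * ET := mul_le_mul_of_nonneg_left hT (by linarith)
  have h2 : (1 - θG) * (cG * t ^ 2) ≤ (1 - θG) * EG := mul_le_mul_of_nonneg_left hG (by linarith)
  have hm1 : min ((1 - θT) * cT) ((1 - θG) * cG) * s ^ 2 ≤ (1 - θT) * cT * s ^ 2 :=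
    mul_le_mul_of_nonneg_right (min_le_left _ _) (sq_nonneg _)
  have hm2 : min ((1 - θT) * cT) ((1 - θG) * cG) * t ^ 2 ≤ (1 - θG) * cG * t ^ 2 :=
    mul_le_mul_of_nonneg_right (min_le_right _ _) (sq_nonneg _)
  have hst : m * (s * t) ≤ m / 2 * (s ^ 2 + t ^ 2) := by
    have h0 : s * t ≤ (s ^ 2 + t ^ 2) / 2 := by nlinarith [sq_nonneg (s - t)]
    nlinarith [h0, hm]
  nlinarith [h1, h2, hm1, hm2, hst, hX]

/-! ## §2 The Hodge split `A = Y + D_{U₀}μ`, `D*_{U₀}Y = 0` in the weighted `L²` letters (every background) -/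

section Hodge

variable {F : T3Family} {n K : ℕ} {h : n ≤ K} {c₀ cB : ℝ} [Fact (0 < c₀)]

/-- **TRANSVERSE FIELDS ARE ORTHOGONAL TO GAUGE DIRECTIONS**: `D*_{U₀}Y = 0 ⟹ ⟪D_{U₀}μ, Y⟫ = 0`. [cite: Balaban1985BackgroundPropagators, (3.8) p.392, (3.118) p.419] -/
theorem inner_DL2_eq_zero_of_transverse (U₀ : GaugeField (F.P K) 0 (Matrix.specialUnitaryGroup (Fin 2) ℂ))
    {Y : BondL2K ℂ 3 (periodsT3 F K) c₀ W₂} (hY : DstarL2 F n K c₀ U₀ Y = 0) (μ : SiteL2K ℂ 3 (periodsT3 F K) c₀ W₂) :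
    ⟪DL2 F n K c₀ U₀ μ, Y⟫_ℂ = 0 := by
  rw [inner_DL2_left, hY, inner_zero_right]

/-- ★ **THE HODGE SPLIT AT THE MEMBER, EVERY BACKGROUND**: every vector field is `A = Y + D_{U₀}μ` with `D*_{U₀}Y = 0` and `‖A‖² = ‖Y‖² + ‖D_{U₀}μ‖²` — the orthogonal projection
of the finite-dimensional weighted `L²` space onto `range D_{U₀}` (`(range D)ᗮ = ker D*`). [cite: Balaban1985BackgroundPropagators, (3.118) p.419, (3.8) p.392; Balaban1984PropagatorsI, (1.21) p.21] -/
theorem exists_hodge_split (U₀ : GaugeField (F.P K) 0 (Matrix.specialUnitaryGroup (Fin 2) ℂ)) (A : BondL2K ℂ 3 (periodsT3 F K) c₀ W₂) :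
    ∃ (Y : BondL2K ℂ 3 (periodsT3 F K) c₀ W₂) (μ : SiteL2K ℂ 3 (periodsT3 F K) c₀ W₂),
      DstarL2 F n K c₀ U₀ Y = 0 ∧ A = Y + DL2 F n K c₀ U₀ μ ∧ ‖A‖ ^ 2 = ‖Y‖ ^ 2 + ‖DL2 F n K c₀ U₀ μ‖ ^ 2 := by
  obtain ⟨g, hg, z, hz, hA⟩ := Submodule.exists_add_mem_mem_orthogonal (K := LinearMap.range (DL2 F n K c₀ U₀)) A
  obtain ⟨μ, rfl⟩ := LinearMap.mem_range.1 hg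
  have hzD : DstarL2 F n K c₀ U₀ z = 0 := by
    have h0 : ⟪DL2 F n K c₀ U₀ (DstarL2 F n K c₀ U₀ z), z⟫_ℂ = 0 :=
      (Submodule.mem_orthogonal _ _).1 hz _ (LinearMap.mem_range_self _ _)
    rw [inner_DL2_left] at h0
    exact inner_self_eq_zero.1 h0
  have horth : ⟪z, DL2 F n K c₀ U₀ μ⟫_ℂ = 0 := by
    rw [← inner_conj_symm, inner_DL2_eq_zero_of_transverse U₀ hzD μ, map_zero]
  have hP := norm_add_sq_eq_norm_sq_add_norm_sq_of_inner_eq_zero z (DL2 F n K c₀ U₀ μ) horth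
  refine ⟨z, μ, hzD, by rw [hA, add_comm], ?_⟩
  rw [hA, add_comm (DL2 F n K c₀ U₀ μ) z, sq, sq, sq]
  exact hP

/-- ★ **ON THE SLICE THE HODGE POTENTIAL SATISFIES `R_S(U₀) Δ^η_{U₀} μ = 0`**: if `D*_{U₀}Y = 0` and `R_S D*(Y + D_{U₀}μ) = 0` then `R_S(D*Dμ) = R_S(Δ^ημ) = 0` — the slice's gauge
directions are the «averaging-visible» ones, `Δ^ημ ⊥ Δ^η N_S(U₀)`. [cite: Balaban1985BackgroundPropagators, (3.21)–(3.23) p.394, (3.118)–(3.119) p.419] -/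
theorem RS_covLapSite_eq_zero_of_slice (U₀ : GaugeField (F.P K) 0 (Matrix.specialUnitaryGroup (Fin 2) ℂ))
    {Y : BondL2K ℂ 3 (periodsT3 F K) c₀ W₂} (hY : DstarL2 F n K c₀ U₀ Y = 0) (μ : SiteL2K ℂ 3 (periodsT3 F K) c₀ W₂)
    (hA : RS F n K h c₀ cB U₀ (DstarL2 F n K c₀ U₀ (Y + DL2 F n K c₀ U₀ μ)) = 0) :
    RS F n K h c₀ cB U₀ (covLapSite F n K c₀ U₀ μ) = 0 := by
  have e : covLapSite F n K c₀ U₀ μ = DstarL2 F n K c₀ U₀ (DL2 F n K c₀ U₀ μ) := rfl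
  rwa [map_add, hY, zero_add, ← e] at hA

end Hodge

/-! ## §3 The expansion algebra -/

section Algebra

variable {E G : Type*} [NormedAddCommGroup E] [InnerProductSpace ℂ E] [NormedAddCommGroup G] [InnerProductSpace ℂ G]

/-- `re⟪Y + X, M(Y + X)⟫ = re⟪Y, MY⟫ + re⟪X, MX⟫ + (re⟪Y, MX⟫ + re⟪X, MY⟫)` for a linear `M`. [folklore] -/
theorem re_inner_add_map_add (M : E →ₗ[ℂ] E) (Y X : E) :
    RCLike.re ⟪Y + X, M (Y + X)⟫_ℂ
      = RCLike.re ⟪Y, M Y⟫_ℂ + RCLike.re ⟪X, M X⟫_ℂ + (RCLike.re ⟪Y, M X⟫_ℂ + RCLike.re ⟪X, M Y⟫_ℂ) := by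
  simp only [map_add, inner_add_left, inner_add_right]
  ring

/-- `‖Q(Y + X)‖² = ‖QY‖² + ‖QX‖² + 2·re⟪QY, QX⟫` for a linear `Q`. [folklore] -/
theorem norm_sq_map_add (Q : E →ₗ[ℂ] G) (Y X : E) :
    ‖Q (Y + X)‖ ^ 2 = ‖Q Y‖ ^ 2 + ‖Q X‖ ^ 2 + 2 * RCLike.re ⟪Q Y, Q X⟫_ℂ := by
  rw [map_add, @norm_add_sq ℂ]
  ring

/-- For a symmetric `M`: `re⟪X, MY⟫ = re⟪Y, MX⟫`. [folklore] -/
theorem re_inner_symm_of_isSymmetric {M : E →ₗ[ℂ] E} (hM : M.IsSymmetric) (Y X : E) :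
    RCLike.re ⟪X, M Y⟫_ℂ = RCLike.re ⟪Y, M X⟫_ℂ := by
  rw [← hM X Y, ← inner_conj_symm, RCLike.conj_re]

/-- ★ **ONLY THE COMPONENT ALONG `v` MIXES**: `|re⟪u, v⟫| ≤ ‖u − w‖·‖v‖` for every `w ⊥ v` — with `u := Q_kY`, `v := Q_kD_{U₀}μ = η²·D′(Q″μ)` (a coarse gauge direction) the
averaging part of the mixing row is controlled by the distance of `Q_kY` from the orthocomplement of the coarse gauge directions, the quantity [Balaban1984PropagatorsI] (1.90)
bounds mode by mode. [cite: Balaban1984PropagatorsI, Prop. 1.1 (1.90) p.33] -/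
theorem abs_re_inner_le_of_orthogonal (u v w : G) (hw : ⟪w, v⟫_ℂ = 0) :
    |RCLike.re ⟪u, v⟫_ℂ| ≤ ‖u - w‖ * ‖v‖ := by
  have e : ⟪u, v⟫_ℂ = ⟪u - w, v⟫_ℂ := by rw [inner_sub_left, hw, sub_zero]
  rw [e]
  exact (RCLike.abs_re_le_norm _).trans (norm_inner_le_norm _ _)

end Algebra

/-! ## §4 THE DOOR: the γ-row on the slice from (T), (G), (X) — every background, every slot operator -/

section Door

variable {F : T3Family} {n K : ℕ} {h : n ≤ K} {c₀ cB a : ℝ} [Fact (0 < c₀)] [Fact (0 < cB)]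

/-- ★★★ **THE SCHUR DOOR OF THE γ-ROW** (every background `U₀`, every `ℂ`-linear slot operator `M` on the vector fields, every coupling `a`).  Rows, in ENERGY CURRENCY
`E_T(Y) := re⟨Y, MY⟩ + a‖Q_kY‖²`, `E_G(μ) := re⟨Dμ, MDμ⟩ + a‖Q_kDμ‖²`:
(T) `c_T‖Y‖² ≤ E_T(Y)` for transverse `Y` (`D*_{U₀}Y = 0`); (G) `c_G‖D_{U₀}μ‖² ≤ E_G(μ)` for slice gauge directions (`R_S(U₀)Δ^η_{U₀}μ = 0`);
(X) `−(θ_T·E_T(Y) + θ_G·E_G(μ) + m·‖Y‖·‖Dμ‖) ≤ re⟨Y, MDμ⟩ + re⟨Dμ, MY⟩ + 2a·re⟨Q_kY, Q_kDμ⟩` for such pairs, with `θ_T, θ_G ≤ 1`, `0 ≤ m`.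
CONCLUSION: `(min((1−θ_T)c_T, (1−θ_G)c_G) − m∕2)·‖A‖² ≤ re⟨A, MA⟩ + a‖Q_kA‖²` for every `A` with `R_S(U₀) D*_{U₀} A = 0`.
Proof: Hodge split `A = Y + Dμ` (§2), the slice passes to `μ`, expand (§3), `‖A‖² = ‖Y‖² + ‖Dμ‖²`, §1.
[cite: Balaban1985BackgroundPropagators, Thm 3.11 p.416, (3.118)–(3.122) pp.419–420; Balaban1984PropagatorsI, Prop. 1.1 (1.90) p.33] -/
theorem gaugeFixedFloor_of_TGX (U₀ : GaugeField (F.P K) 0 (Matrix.specialUnitaryGroup (Fin 2) ℂ))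
    (M : BondL2K ℂ 3 (periodsT3 F K) c₀ W₂ →ₗ[ℂ] BondL2K ℂ 3 (periodsT3 F K) c₀ W₂) {cT cG θT θG m : ℝ}
    (hθT : θT ≤ 1) (hθG : θG ≤ 1) (hm : 0 ≤ m)
    (hT : ∀ Y : BondL2K ℂ 3 (periodsT3 F K) c₀ W₂, DstarL2 F n K c₀ U₀ Y = 0 →
      cT * ‖Y‖ ^ 2 ≤ RCLike.re ⟪Y, M Y⟫_ℂ + a * ‖Qk F n K h c₀ cB U₀ Y‖ ^ 2)
    (hG : ∀ μ : SiteL2K ℂ 3 (periodsT3 F K) c₀ W₂, RS F n K h c₀ cB U₀ (covLapSite F n K c₀ U₀ μ) = 0 →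
      cG * ‖DL2 F n K c₀ U₀ μ‖ ^ 2 ≤ RCLike.re ⟪DL2 F n K c₀ U₀ μ, M (DL2 F n K c₀ U₀ μ)⟫_ℂ + a * ‖Qk F n K h c₀ cB U₀ (DL2 F n K c₀ U₀ μ)‖ ^ 2)
    (hX : ∀ (Y : BondL2K ℂ 3 (periodsT3 F K) c₀ W₂) (μ : SiteL2K ℂ 3 (periodsT3 F K) c₀ W₂), DstarL2 F n K c₀ U₀ Y = 0 →
      RS F n K h c₀ cB U₀ (covLapSite F n K c₀ U₀ μ) = 0 →
        -(θT * (RCLike.re ⟪Y, M Y⟫_ℂ + a * ‖Qk F n K h c₀ cB U₀ Y‖ ^ 2)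
            + θG * (RCLike.re ⟪DL2 F n K c₀ U₀ μ, M (DL2 F n K c₀ U₀ μ)⟫_ℂ + a * ‖Qk F n K h c₀ cB U₀ (DL2 F n K c₀ U₀ μ)‖ ^ 2)
            + m * (‖Y‖ * ‖DL2 F n K c₀ U₀ μ‖)) ≤
          RCLike.re ⟪Y, M (DL2 F n K c₀ U₀ μ)⟫_ℂ + RCLike.re ⟪DL2 F n K c₀ U₀ μ, M Y⟫_ℂ
            + 2 * a * RCLike.re ⟪Qk F n K h c₀ cB U₀ Y, Qk F n K h c₀ cB U₀ (DL2 F n K c₀ U₀ μ)⟫_ℂ) :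
    ∀ A : BondL2K ℂ 3 (periodsT3 F K) c₀ W₂, RS F n K h c₀ cB U₀ (DstarL2 F n K c₀ U₀ A) = 0 →
      (min ((1 - θT) * cT) ((1 - θG) * cG) - m / 2) * ‖A‖ ^ 2 ≤ RCLike.re ⟪A, M A⟫_ℂ + a * ‖Qk F n K h c₀ cB U₀ A‖ ^ 2 := by
  intro A hA
  obtain ⟨Y, μ, hY, hAeq, hnorm⟩ := exists_hodge_split (n := n) U₀ A
  have hμ : RS F n K h c₀ cB U₀ (covLapSite F n K c₀ U₀ μ) = 0 :=
    RS_covLapSite_eq_zero_of_slice U₀ hY μ (hAeq ▸ hA)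
  have key := floor_arith hθT hθG hm (s := ‖Y‖) (t := ‖DL2 F n K c₀ U₀ μ‖) (hT Y hY) (hG μ hμ) (hX Y μ hY hμ)
  have e : RCLike.re ⟪A, M A⟫_ℂ + a * ‖Qk F n K h c₀ cB U₀ A‖ ^ 2
      = (RCLike.re ⟪Y, M Y⟫_ℂ + a * ‖Qk F n K h c₀ cB U₀ Y‖ ^ 2)
        + (RCLike.re ⟪DL2 F n K c₀ U₀ μ, M (DL2 F n K c₀ U₀ μ)⟫_ℂ + a * ‖Qk F n K h c₀ cB U₀ (DL2 F n K c₀ U₀ μ)‖ ^ 2)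
        + (RCLike.re ⟪Y, M (DL2 F n K c₀ U₀ μ)⟫_ℂ + RCLike.re ⟪DL2 F n K c₀ U₀ μ, M Y⟫_ℂ
            + 2 * a * RCLike.re ⟪Qk F n K h c₀ cB U₀ Y, Qk F n K h c₀ cB U₀ (DL2 F n K c₀ U₀ μ)⟫_ℂ) := by
    rw [hAeq, re_inner_add_map_add, norm_sq_map_add]
    ring
  rw [e, hnorm]
  exact key

/-- ★★ **THE DOOR AT A SYMMETRIC SLOT** (`M` symmetric, e.g. `Δ^η(U₀)`, `Δ^η(U₀) + T_J(U₀)` at `RegPr`): the mixing row reads `−(…) ≤ 2·re⟨Y, M Dμ⟩ + 2a·re⟨Q_kY, Q_kDμ⟩`.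
[cite: Balaban1985BackgroundPropagators, Thm 3.11 p.416, (3.118)–(3.122) pp.419–420, (3.10)–(3.12) p.392] -/
theorem gaugeFixedFloor_of_TGX_of_isSymmetric (U₀ : GaugeField (F.P K) 0 (Matrix.specialUnitaryGroup (Fin 2) ℂ))
    {M : BondL2K ℂ 3 (periodsT3 F K) c₀ W₂ →ₗ[ℂ] BondL2K ℂ 3 (periodsT3 F K) c₀ W₂} (hM : M.IsSymmetric) {cT cG θT θG m : ℝ}
    (hθT : θT ≤ 1) (hθG : θG ≤ 1) (hm : 0 ≤ m)
    (hT : ∀ Y : BondL2K ℂ 3 (periodsT3 F K) c₀ W₂, DstarL2 F n K c₀ U₀ Y = 0 →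
      cT * ‖Y‖ ^ 2 ≤ RCLike.re ⟪Y, M Y⟫_ℂ + a * ‖Qk F n K h c₀ cB U₀ Y‖ ^ 2)
    (hG : ∀ μ : SiteL2K ℂ 3 (periodsT3 F K) c₀ W₂, RS F n K h c₀ cB U₀ (covLapSite F n K c₀ U₀ μ) = 0 →
      cG * ‖DL2 F n K c₀ U₀ μ‖ ^ 2 ≤ RCLike.re ⟪DL2 F n K c₀ U₀ μ, M (DL2 F n K c₀ U₀ μ)⟫_ℂ + a * ‖Qk F n K h c₀ cB U₀ (DL2 F n K c₀ U₀ μ)‖ ^ 2)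
    (hX : ∀ (Y : BondL2K ℂ 3 (periodsT3 F K) c₀ W₂) (μ : SiteL2K ℂ 3 (periodsT3 F K) c₀ W₂), DstarL2 F n K c₀ U₀ Y = 0 →
      RS F n K h c₀ cB U₀ (covLapSite F n K c₀ U₀ μ) = 0 →
        -(θT * (RCLike.re ⟪Y, M Y⟫_ℂ + a * ‖Qk F n K h c₀ cB U₀ Y‖ ^ 2)
            + θG * (RCLike.re ⟪DL2 F n K c₀ U₀ μ, M (DL2 F n K c₀ U₀ μ)⟫_ℂ + a * ‖Qk F n K h c₀ cB U₀ (DL2 F n K c₀ U₀ μ)‖ ^ 2)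
            + m * (‖Y‖ * ‖DL2 F n K c₀ U₀ μ‖)) ≤
          2 * RCLike.re ⟪Y, M (DL2 F n K c₀ U₀ μ)⟫_ℂ
            + 2 * a * RCLike.re ⟪Qk F n K h c₀ cB U₀ Y, Qk F n K h c₀ cB U₀ (DL2 F n K c₀ U₀ μ)⟫_ℂ) :
    ∀ A : BondL2K ℂ 3 (periodsT3 F K) c₀ W₂, RS F n K h c₀ cB U₀ (DstarL2 F n K c₀ U₀ A) = 0 →
      (min ((1 - θT) * cT) ((1 - θG) * cG) - m / 2) * ‖A‖ ^ 2 ≤ RCLike.re ⟪A, M A⟫_ℂ + a * ‖Qk F n K h c₀ cB U₀ A‖ ^ 2 := by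
  refine gaugeFixedFloor_of_TGX U₀ M hθT hθG hm hT hG fun Y μ hY hμ => ?_
  rw [re_inner_symm_of_isSymmetric hM Y (DL2 F n K c₀ U₀ μ), ← two_mul]
  exact hX Y μ hY hμ

/-- ★★ **THE DOOR AT THE SLOT OF THE `hGF` BINDER, `M := Δ^η(U₀)`** (symmetric, ✓`DeltaEta_isSymmetric`; every background): (T), (G) and the one-sided mixing row
`−(θ_T E_T + θ_G E_G + m‖Y‖‖Dμ‖) ≤ 2re⟨Y, Δ^η(U₀)Dμ⟩ + 2a re⟨Q_kY, Q_kDμ⟩` give `(min((1−θ_T)c_T, (1−θ_G)c_G) − m∕2)‖A‖² ≤ re⟨A, Δ^η(U₀)A⟩ + a‖Q_kA‖²` on `{R_S D* A = 0}`.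
[cite: Balaban1985BackgroundPropagators, Thm 3.11 p.416, (3.118)–(3.122) pp.419–420] -/
theorem gaugeFixedFloor_DeltaEta_of_TGX (U₀ : GaugeField (F.P K) 0 (Matrix.specialUnitaryGroup (Fin 2) ℂ)) {cT cG θT θG m : ℝ}
    (hθT : θT ≤ 1) (hθG : θG ≤ 1) (hm : 0 ≤ m)
    (hT : ∀ Y : BondL2K ℂ 3 (periodsT3 F K) c₀ W₂, DstarL2 F n K c₀ U₀ Y = 0 →
      cT * ‖Y‖ ^ 2 ≤ RCLike.re ⟪Y, DeltaEta F n K c₀ U₀ Y⟫_ℂ + a * ‖Qk F n K h c₀ cB U₀ Y‖ ^ 2)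
    (hG : ∀ μ : SiteL2K ℂ 3 (periodsT3 F K) c₀ W₂, RS F n K h c₀ cB U₀ (covLapSite F n K c₀ U₀ μ) = 0 →
      cG * ‖DL2 F n K c₀ U₀ μ‖ ^ 2 ≤ RCLike.re ⟪DL2 F n K c₀ U₀ μ, DeltaEta F n K c₀ U₀ (DL2 F n K c₀ U₀ μ)⟫_ℂ
        + a * ‖Qk F n K h c₀ cB U₀ (DL2 F n K c₀ U₀ μ)‖ ^ 2)
    (hX : ∀ (Y : BondL2K ℂ 3 (periodsT3 F K) c₀ W₂) (μ : SiteL2K ℂ 3 (periodsT3 F K) c₀ W₂), DstarL2 F n K c₀ U₀ Y = 0 →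
      RS F n K h c₀ cB U₀ (covLapSite F n K c₀ U₀ μ) = 0 →
        -(θT * (RCLike.re ⟪Y, DeltaEta F n K c₀ U₀ Y⟫_ℂ + a * ‖Qk F n K h c₀ cB U₀ Y‖ ^ 2)
            + θG * (RCLike.re ⟪DL2 F n K c₀ U₀ μ, DeltaEta F n K c₀ U₀ (DL2 F n K c₀ U₀ μ)⟫_ℂ + a * ‖Qk F n K h c₀ cB U₀ (DL2 F n K c₀ U₀ μ)‖ ^ 2)
            + m * (‖Y‖ * ‖DL2 F n K c₀ U₀ μ‖)) ≤
          2 * RCLike.re ⟪Y, DeltaEta F n K c₀ U₀ (DL2 F n K c₀ U₀ μ)⟫_ℂ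
            + 2 * a * RCLike.re ⟪Qk F n K h c₀ cB U₀ Y, Qk F n K h c₀ cB U₀ (DL2 F n K c₀ U₀ μ)⟫_ℂ) :
    ∀ A : BondL2K ℂ 3 (periodsT3 F K) c₀ W₂, RS F n K h c₀ cB U₀ (DstarL2 F n K c₀ U₀ A) = 0 →
      (min ((1 - θT) * cT) ((1 - θG) * cG) - m / 2) * ‖A‖ ^ 2
        ≤ RCLike.re ⟪A, DeltaEta F n K c₀ U₀ A⟫_ℂ + a * ‖Qk F n K h c₀ cB U₀ A‖ ^ 2 :=
  gaugeFixedFloor_of_TGX_of_isSymmetric U₀ (DeltaEta_isSymmetric U₀) hθT hθG hm hT hG hX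

/-! ## §5 Necessity: (T) and (G) are the γ-row restricted to two subspaces of the slice -/

/-- ★ **(T) IS NECESSARY**: a transverse field lies on the slice (`D*Y = 0 ⟹ R_S D*Y = 0`), so the γ-row gives (T) with `c_T := γ`.
[cite: Balaban1985BackgroundPropagators, (3.118)–(3.119) p.419] -/
theorem transverseFloor_of_gaugeFixedFloor (U₀ : GaugeField (F.P K) 0 (Matrix.specialUnitaryGroup (Fin 2) ℂ))
    (M : BondL2K ℂ 3 (periodsT3 F K) c₀ W₂ →ₗ[ℂ] BondL2K ℂ 3 (periodsT3 F K) c₀ W₂) {γ : ℝ}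
    (hGF : ∀ A : BondL2K ℂ 3 (periodsT3 F K) c₀ W₂, RS F n K h c₀ cB U₀ (DstarL2 F n K c₀ U₀ A) = 0 →
      γ * ‖A‖ ^ 2 ≤ RCLike.re ⟪A, M A⟫_ℂ + a * ‖Qk F n K h c₀ cB U₀ A‖ ^ 2) :
    ∀ Y : BondL2K ℂ 3 (periodsT3 F K) c₀ W₂, DstarL2 F n K c₀ U₀ Y = 0 →
      γ * ‖Y‖ ^ 2 ≤ RCLike.re ⟪Y, M Y⟫_ℂ + a * ‖Qk F n K h c₀ cB U₀ Y‖ ^ 2 :=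
  fun Y hY => hGF Y (by rw [hY, map_zero])

/-- ★ **(G) IS NECESSARY**: a slice gauge direction `D_{U₀}μ` (`R_S Δ^ημ = 0`) lies on the slice (`D*Dμ = Δ^ημ`), so the γ-row gives (G) with `c_G := γ`.
[cite: Balaban1985BackgroundPropagators, (3.21)–(3.23) p.394, (3.118)–(3.119) p.419] -/
theorem sliceGaugeFloor_of_gaugeFixedFloor (U₀ : GaugeField (F.P K) 0 (Matrix.specialUnitaryGroup (Fin 2) ℂ))
    (M : BondL2K ℂ 3 (periodsT3 F K) c₀ W₂ →ₗ[ℂ] BondL2K ℂ 3 (periodsT3 F K) c₀ W₂) {γ : ℝ}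
    (hGF : ∀ A : BondL2K ℂ 3 (periodsT3 F K) c₀ W₂, RS F n K h c₀ cB U₀ (DstarL2 F n K c₀ U₀ A) = 0 →
      γ * ‖A‖ ^ 2 ≤ RCLike.re ⟪A, M A⟫_ℂ + a * ‖Qk F n K h c₀ cB U₀ A‖ ^ 2) :
    ∀ μ : SiteL2K ℂ 3 (periodsT3 F K) c₀ W₂, RS F n K h c₀ cB U₀ (covLapSite F n K c₀ U₀ μ) = 0 →
      γ * ‖DL2 F n K c₀ U₀ μ‖ ^ 2 ≤ RCLike.re ⟪DL2 F n K c₀ U₀ μ, M (DL2 F n K c₀ U₀ μ)⟫_ℂ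
        + a * ‖Qk F n K h c₀ cB U₀ (DL2 F n K c₀ U₀ μ)‖ ^ 2 :=
  fun μ hμ => hGF (DL2 F n K c₀ U₀ μ) hμ

/-! ## §6 The averaging part of (X) in intertwiner letters -/

omit [Fact (0 < c₀)] in
/-- `⟪Q_ku, Q_kv⟫ = η²·⟪Qu, Qv⟫` (`Q_k = η • Q` in A-units, `η` real). [cite: Balaban1985Variational, (44)–(45) p.285] -/
theorem inner_Qk_Qk (U₀ : GaugeField (F.P K) 0 (Matrix.specialUnitaryGroup (Fin 2) ℂ)) (u v : BondL2K ℂ 3 (periodsT3 F K) c₀ W₂) :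
    ⟪Qk F n K h c₀ cB U₀ u, Qk F n K h c₀ cB U₀ v⟫_ℂ = ((eta F n K : ℝ) : ℂ) ^ 2 * ⟪QL2 F n K h c₀ cB U₀ u, QL2 F n K h c₀ cB U₀ v⟫_ℂ := by
  show ⟪(((eta F n K : ℝ) : ℂ)) • QL2 F n K h c₀ cB U₀ u, (((eta F n K : ℝ) : ℂ)) • QL2 F n K h c₀ cB U₀ v⟫_ℂ = _
  rw [inner_smul_left, inner_smul_right, Complex.conj_ofReal]
  ring

/-- ★ **THE AVERAGING MIXING TERM THROUGH THE INTERTWINER `Q(U₀)∘D_{U₀} = D′∘Q″`** (the shape (i) of ✓`Prop7NSIntertwinerOfRecord.exists_intertwiner_of_regPr`, any `Q″`, `D′`):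
`⟪Q_kY, Q_kD_{U₀}μ⟫ = η²·⟪QY, D′(Q″μ)⟫` — so the row's averaging part is the pairing of `QY` with a COARSE GAUGE DIRECTION `D′ν`, `ν = Q″μ`; with the adjoint intertwiner
(pen (a)) it becomes `η²·⟪D′†(QY), Q″μ⟫`. [cite: Balaban1985BackgroundPropagators, (3.114)–(3.115) p.418] -/
theorem inner_Qk_Qk_DL2_of_intertwiner (U₀ : GaugeField (F.P K) 0 (Matrix.specialUnitaryGroup (Fin 2) ℂ))
    {C : Type*} [AddCommGroup C] [Module ℂ C] (Q'' : SiteL2K ℂ 3 (periodsT3 F K) c₀ W₂ →ₗ[ℂ] C)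
    (D' : C →ₗ[ℂ] WL2 ℂ (fun _ : PBond (F.P n) 0 => cB) W₂)
    (hQD : ∀ l : SiteL2K ℂ 3 (periodsT3 F K) c₀ W₂, QL2 F n K h c₀ cB U₀ (DL2 F n K c₀ U₀ l) = D' (Q'' l))
    (Y : BondL2K ℂ 3 (periodsT3 F K) c₀ W₂) (μ : SiteL2K ℂ 3 (periodsT3 F K) c₀ W₂) :
    ⟪Qk F n K h c₀ cB U₀ Y, Qk F n K h c₀ cB U₀ (DL2 F n K c₀ U₀ μ)⟫_ℂ = ((eta F n K : ℝ) : ℂ) ^ 2 * ⟪QL2 F n K h c₀ cB U₀ Y, D' (Q'' μ)⟫_ℂ := by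
  rw [inner_Qk_Qk, hQD]

/-- ★ **THE AVERAGING MIXING TERM IS A DISTANCE**: for every coarse `w` orthogonal to `Q_kD_{U₀}μ`, `|re⟪Q_kY, Q_kDμ⟫| ≤ ‖Q_kY − w‖·‖Q_kDμ‖` — only the component of `Q_kY`
along the coarse gauge direction enters (for transverse `Y` this component is the «`D̄*∘Q ≠ Q″∘D*`» defect of LOCATE-GAMMA-ROW §1 (X)). [cite: Balaban1984PropagatorsI, Prop. 1.1 (1.90) p.33] -/
theorem abs_re_inner_Qk_le (U₀ : GaugeField (F.P K) 0 (Matrix.specialUnitaryGroup (Fin 2) ℂ)) (Y : BondL2K ℂ 3 (periodsT3 F K) c₀ W₂)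
    (μ : SiteL2K ℂ 3 (periodsT3 F K) c₀ W₂) (w : WL2 ℂ (fun _ : PBond (F.P n) 0 => cB) W₂)
    (hw : ⟪w, Qk F n K h c₀ cB U₀ (DL2 F n K c₀ U₀ μ)⟫_ℂ = 0) :
    |RCLike.re ⟪Qk F n K h c₀ cB U₀ Y, Qk F n K h c₀ cB U₀ (DL2 F n K c₀ U₀ μ)⟫_ℂ|
      ≤ ‖Qk F n K h c₀ cB U₀ Y - w‖ * ‖Qk F n K h c₀ cB U₀ (DL2 F n K c₀ U₀ μ)‖ :=
  abs_re_inner_le_of_orthogonal _ _ w hw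

end Door

/-! ## §7 The family door: the `hGF` binder of the positivity-block door from family-level (T), (G), (X) rows -/

section Family

/-- ★★★ **THE FAMILY DOOR** — the `hGF` hypothesis of ✓`Prop7PositivityBlockDoorLift.positivityRows_liftRecord_of_gaugeFixedRow` VERBATIM (slot `Δ^η`, radius `αcap`, every
`U₀ ∈ RegPr ρ`, `ρ ≤ αcap L`) from the three rows of LOCATE-GAMMA-ROW §1 displayed at family level under the same binders: (T) transverse floor `c_T L i`, (G) slice-gauge floor
`c_G L i`, (X) one-sided mixing in energy currency with fractions `θ_T L i, θ_G L i ≤ 1` and `0 ≤ m L i`; then `hGF` holds with `γ L i := min((1−θ_T)c_T, (1−θ_G)c_G) − m∕2`.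
[cite: Balaban1985BackgroundPropagators, Thm 3.11 p.416, (3.118)–(3.122) pp.419–420; Balaban1984PropagatorsI, Prop. 1.1 (1.90) p.33] -/
theorem hGF_of_TGX_rows (αcap : ℕ → ℝ) (c₀ cB : ℕ → ℝ) [hc₀ : ∀ L : ℕ, Fact (0 < c₀ L)] [hcB : ∀ L : ℕ, Fact (0 < cB L)]
    (a : ∀ L : ℕ, Idx L → ℝ) (cT cG θT θG m : ∀ L : ℕ, Idx L → ℝ)
    (hθT : ∀ (L : ℕ) (i : Idx L), θT L i ≤ 1) (hθG : ∀ (L : ℕ) (i : Idx L), θG L i ≤ 1) (hm : ∀ (L : ℕ) (i : Idx L), 0 ≤ m L i)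
    (hT : ∀ (L : ℕ), 1 < L → ∀ (i : Idx L) (U₀ : GaugeField (i.1.1.P i.1.2.2) 0 (Matrix.specialUnitaryGroup (Fin 2) ℂ)), ∀ ρ : ℝ,
      RegPr i.1.1 i.1.2.1 i.1.2.2 ρ U₀ → ρ ≤ αcap L →
        ∀ Y : BondL2K ℂ 3 (periodsT3 i.1.1 i.1.2.2) (c₀ L) W₂, DstarL2 i.1.1 i.1.2.1 i.1.2.2 (c₀ L) U₀ Y = 0 →
          cT L i * ‖Y‖ ^ 2 ≤ RCLike.re ⟪Y, DeltaEta i.1.1 i.1.2.1 i.1.2.2 (c₀ L) U₀ Y⟫_ℂ + a L i * ‖Qk i.1.1 i.1.2.1 i.1.2.2 i.2.2.le (c₀ L) (cB L) U₀ Y‖ ^ 2)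
    (hG : ∀ (L : ℕ), 1 < L → ∀ (i : Idx L) (U₀ : GaugeField (i.1.1.P i.1.2.2) 0 (Matrix.specialUnitaryGroup (Fin 2) ℂ)), ∀ ρ : ℝ,
      RegPr i.1.1 i.1.2.1 i.1.2.2 ρ U₀ → ρ ≤ αcap L →
        ∀ μ : SiteL2K ℂ 3 (periodsT3 i.1.1 i.1.2.2) (c₀ L) W₂,
          RS i.1.1 i.1.2.1 i.1.2.2 i.2.2.le (c₀ L) (cB L) U₀ (covLapSite i.1.1 i.1.2.1 i.1.2.2 (c₀ L) U₀ μ) = 0 →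
            cG L i * ‖DL2 i.1.1 i.1.2.1 i.1.2.2 (c₀ L) U₀ μ‖ ^ 2
              ≤ RCLike.re ⟪DL2 i.1.1 i.1.2.1 i.1.2.2 (c₀ L) U₀ μ, DeltaEta i.1.1 i.1.2.1 i.1.2.2 (c₀ L) U₀ (DL2 i.1.1 i.1.2.1 i.1.2.2 (c₀ L) U₀ μ)⟫_ℂ
                + a L i * ‖Qk i.1.1 i.1.2.1 i.1.2.2 i.2.2.le (c₀ L) (cB L) U₀ (DL2 i.1.1 i.1.2.1 i.1.2.2 (c₀ L) U₀ μ)‖ ^ 2)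
    (hX : ∀ (L : ℕ), 1 < L → ∀ (i : Idx L) (U₀ : GaugeField (i.1.1.P i.1.2.2) 0 (Matrix.specialUnitaryGroup (Fin 2) ℂ)), ∀ ρ : ℝ,
      RegPr i.1.1 i.1.2.1 i.1.2.2 ρ U₀ → ρ ≤ αcap L →
        ∀ (Y : BondL2K ℂ 3 (periodsT3 i.1.1 i.1.2.2) (c₀ L) W₂) (μ : SiteL2K ℂ 3 (periodsT3 i.1.1 i.1.2.2) (c₀ L) W₂),
          DstarL2 i.1.1 i.1.2.1 i.1.2.2 (c₀ L) U₀ Y = 0 →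
          RS i.1.1 i.1.2.1 i.1.2.2 i.2.2.le (c₀ L) (cB L) U₀ (covLapSite i.1.1 i.1.2.1 i.1.2.2 (c₀ L) U₀ μ) = 0 →
            -(θT L i * (RCLike.re ⟪Y, DeltaEta i.1.1 i.1.2.1 i.1.2.2 (c₀ L) U₀ Y⟫_ℂ + a L i * ‖Qk i.1.1 i.1.2.1 i.1.2.2 i.2.2.le (c₀ L) (cB L) U₀ Y‖ ^ 2)
                + θG L i * (RCLike.re ⟪DL2 i.1.1 i.1.2.1 i.1.2.2 (c₀ L) U₀ μ,
                    DeltaEta i.1.1 i.1.2.1 i.1.2.2 (c₀ L) U₀ (DL2 i.1.1 i.1.2.1 i.1.2.2 (c₀ L) U₀ μ)⟫_ℂ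
                    + a L i * ‖Qk i.1.1 i.1.2.1 i.1.2.2 i.2.2.le (c₀ L) (cB L) U₀ (DL2 i.1.1 i.1.2.1 i.1.2.2 (c₀ L) U₀ μ)‖ ^ 2)
                + m L i * (‖Y‖ * ‖DL2 i.1.1 i.1.2.1 i.1.2.2 (c₀ L) U₀ μ‖)) ≤
              2 * RCLike.re ⟪Y, DeltaEta i.1.1 i.1.2.1 i.1.2.2 (c₀ L) U₀ (DL2 i.1.1 i.1.2.1 i.1.2.2 (c₀ L) U₀ μ)⟫_ℂ
                + 2 * a L i * RCLike.re ⟪Qk i.1.1 i.1.2.1 i.1.2.2 i.2.2.le (c₀ L) (cB L) U₀ Y,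
                    Qk i.1.1 i.1.2.1 i.1.2.2 i.2.2.le (c₀ L) (cB L) U₀ (DL2 i.1.1 i.1.2.1 i.1.2.2 (c₀ L) U₀ μ)⟫_ℂ) :
    ∀ (L : ℕ), 1 < L → ∀ (i : Idx L) (U₀ : GaugeField (i.1.1.P i.1.2.2) 0 (Matrix.specialUnitaryGroup (Fin 2) ℂ)), ∀ ρ : ℝ,
      RegPr i.1.1 i.1.2.1 i.1.2.2 ρ U₀ → ρ ≤ αcap L →
        ∀ A : BondL2K ℂ 3 (periodsT3 i.1.1 i.1.2.2) (c₀ L) W₂,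
          RS i.1.1 i.1.2.1 i.1.2.2 i.2.2.le (c₀ L) (cB L) U₀ (DstarL2 i.1.1 i.1.2.1 i.1.2.2 (c₀ L) U₀ A) = 0 →
            (min ((1 - θT L i) * cT L i) ((1 - θG L i) * cG L i) - m L i / 2) * ‖A‖ ^ 2
              ≤ RCLike.re ⟪A, DeltaEta i.1.1 i.1.2.1 i.1.2.2 (c₀ L) U₀ A⟫_ℂ + a L i * ‖Qk i.1.1 i.1.2.1 i.1.2.2 i.2.2.le (c₀ L) (cB L) U₀ A‖ ^ 2 :=
  fun L hL i U₀ ρ hreg hρ =>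
    gaugeFixedFloor_DeltaEta_of_TGX U₀ (hθT L i) (hθG L i) (hm L i) (hT L hL i U₀ ρ hreg hρ) (hG L hL i U₀ ρ hreg hρ) (hX L hL i U₀ ρ hreg hρ)

end Family

end Summit.QuantumFields.YangMills.Theorems.Prop7GaugeFixedFloorSchurDoor

end
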